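import Mathlib
import Summits.Ventures.PercRepro2.Defs
import Summits.Ventures.PercRepro2.Graph
import Summits.Ventures.PercRepro2.MM0Sector
import Summits.Ventures.PercRepro2.MM0Pinned

/-!
# Row 2′MM0: the pinned statement as a counting problem, and the injection form
(blind cell PercRepro2, night-1 g3; `proofs/NIGHT1-MM0.md` §7.5, `proofs/NIGHT1-INJ.md`)

`MM0Pinned.PinnedMM0` says that every three-copy pattern coefficient `c(pat) = ∑_{(x,y,z) ∈ fibre(pat)} K(x,y,z)`
is `≤ 0`.  The kernel takes only the values `−1, 0, 1` (`tripleKernel_eq_prod`: it is the product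
`1_R(y) 1_R(z) 1_gate(x) (1_Y(x) − 1_Y(y)) (1_Zev(x) − 1_Z₀(z))`), so

  `c(pat) = #posFibre(pat) − #negFibre(pat)`   (`patternCoeff3_eq_card_sub_card`),

where `posFibre` = the triples of the fibre with kernel `+1` (marker patterns `(1,1|0,0)`, `(0,0|1,1)`)
and `negFibre` = kernel `−1` (patterns `(1,0|0,1)`, `(0,1|1,0)`).  Hence `PinnedMM0` is EXACTLY the
statement that on every fibre there are at least as many `−1`-triples as `+1`-triples
(`pinnedMM0_iff_card_le`), and an INJECTION `posFibre(pat) → negFibre(pat)` on every fibre proves it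
(`pinnedMM0_of_injection`).

`LocalInjection3` is the injection hypothesis with the FOUR-CLUSTER LOCALITY of `NIGHT1-MM0.md` §9:
the image of `(x, y, z)` agrees with `(x, y, z)` on every edge not touching
`C_x(s) ∪ K⁺_x ∪ C_y(s) ∪ C_z(t)` (`K⁺_x` = the cluster of `t` in `x + uw`).  `pinnedMM0_of_localInjection3`.
The locality is what makes the hypothesis a finite, fibre-by-fibre CENSUS question (Hall's condition
on the bipartite graph of local moves), checked exactly on the `n = 6` atlas (night-1 g3, kit j210362 /
j210363); the theorem says nothing about its truth.  Standard axioms, Mathlib + cell prefix only.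
-/

namespace Summit.Ventures.PercRepro2
namespace MM0Pinned

open MM0Sector

variable {V : Type*} {E : Type*} [Fintype E] [DecidableEq E] [Fintype V] [DecidableEq V]
  {R : Type*} [CommRing R]

/-! ## The kernel as a product -/

section KernelProd

variable (ends : E → Sym2 V) (s t b u w v : V)

omit [Fintype E] [DecidableEq E] [Fintype V] [DecidableEq V] in
open Classical in
/-- The three-copy kernel is the product form
`1_R(y) 1_R(z) 1_gate(x) (1_Y(x) − 1_Y(y)) (1_Zev(x) − 1_Z₀(z))`. -/
theorem tripleKernel_eq_prod (x y z : Config E) :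
    tripleKernel (R := R) ends s t b u w v x y z =
      (if y ∈ (connEvent ends s t)ᶜ then 1 else 0) * (if z ∈ (connEvent ends s t)ᶜ then 1 else 0) *
        (if x ∈ gate ends s t u w then 1 else 0) *
        ((if x ∈ connEvent ends s b then 1 else 0) - (if y ∈ connEvent ends s b then 1 else 0)) *
        ((if x ∈ Zev ends t u w v then 1 else 0) - (if z ∈ connEvent ends t v then 1 else 0)) := by
  unfold tripleKernel
  by_cases hxY : x ∈ connEvent ends s b <;> by_cases hxZ : x ∈ Zev ends t u w v <;>
    by_cases hxG : x ∈ gate ends s t u w <;> by_cases hyY : y ∈ connEvent ends s b <;>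
    by_cases hyR : y ∈ (connEvent ends s t)ᶜ <;> by_cases hzZ : z ∈ connEvent ends t v <;>
    by_cases hzR : z ∈ (connEvent ends s t)ᶜ <;>
    simp [Set.mem_inter_iff, hxY, hxZ, hxG, hyY, hyR, hzZ, hzR]

omit [Fintype E] [DecidableEq E] [Fintype V] [DecidableEq V] in
open Classical in
/-- The kernel takes only the values `−1`, `0`, `1`. -/
theorem tripleKernel_mem (x y z : Config E) :
    tripleKernel (R := R) ends s t b u w v x y z = 1 ∨
      tripleKernel (R := R) ends s t b u w v x y z = 0 ∨
      tripleKernel (R := R) ends s t b u w v x y z = -1 := by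
  rw [tripleKernel_eq_prod]
  by_cases hxY : x ∈ connEvent ends s b <;> by_cases hxZ : x ∈ Zev ends t u w v <;>
    by_cases hxG : x ∈ gate ends s t u w <;> by_cases hyY : y ∈ connEvent ends s b <;>
    by_cases hyR : y ∈ (connEvent ends s t)ᶜ <;> by_cases hzZ : z ∈ connEvent ends t v <;>
    by_cases hzR : z ∈ (connEvent ends s t)ᶜ <;>
    simp [hxY, hxZ, hxG, hyY, hyR, hzZ, hzR]

end KernelProd

/-! ## Fibres and the signed count -/

section Fibres

variable (ends : E → Sym2 V) (s t b u w v : V)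

/-- The order statistics `(lo, med, hi)` of a triple of configurations. -/
def stats (xyz : Config E × Config E × Config E) : Config E × Config E × Config E :=
  (lo xyz.1 xyz.2.1 xyz.2.2, med xyz.1 xyz.2.1 xyz.2.2, xyz.1 ⊔ xyz.2.1 ⊔ xyz.2.2)

open Classical in
/-- The fibre of a pattern: the ordered triples with these order statistics. -/
noncomputable def fibre (pat : Config E × Config E × Config E) :
    Finset (Config E × Config E × Config E) :=
  Finset.univ.filter fun xyz => stats xyz = pat

open Classical in
/-- The triples of the fibre with kernel `+1`. -/
noncomputable def posFibre (pat : Config E × Config E × Config E) :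
    Finset (Config E × Config E × Config E) :=
  (fibre pat).filter fun xyz => tripleKernel (R := R) ends s t b u w v xyz.1 xyz.2.1 xyz.2.2 = 1

open Classical in
/-- The triples of the fibre with kernel `−1`. -/
noncomputable def negFibre (pat : Config E × Config E × Config E) :
    Finset (Config E × Config E × Config E) :=
  (fibre pat).filter fun xyz => tripleKernel (R := R) ends s t b u w v xyz.1 xyz.2.1 xyz.2.2 = -1

variable [LinearOrder R] [IsStrictOrderedRing R]

omit [Fintype V] [DecidableEq V] in
open Classical in
/-- **The pattern coefficient is a signed count**: `c(pat) = #posFibre − #negFibre`. -/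
theorem patternCoeff3_eq_card_sub_card (pat : Config E × Config E × Config E) :
    patternCoeff3 (R := R) ends s t b u w v pat =
      ((posFibre (R := R) ends s t b u w v pat).card : R) -
        ((negFibre (R := R) ends s t b u w v pat).card : R) := by
  have hsum : patternCoeff3 (R := R) ends s t b u w v pat =
      ∑ xyz ∈ fibre pat, tripleKernel (R := R) ends s t b u w v xyz.1 xyz.2.1 xyz.2.2 := by
    unfold patternCoeff3 fibre
    rw [Finset.sum_filter]
    rfl
  have hval : ∀ xyz ∈ fibre pat,
      tripleKernel (R := R) ends s t b u w v xyz.1 xyz.2.1 xyz.2.2 =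
        (if tripleKernel (R := R) ends s t b u w v xyz.1 xyz.2.1 xyz.2.2 = 1 then (1 : R) else 0) -
        (if tripleKernel (R := R) ends s t b u w v xyz.1 xyz.2.1 xyz.2.2 = -1 then (1 : R) else 0) := by
    intro xyz _
    rcases tripleKernel_mem (R := R) ends s t b u w v xyz.1 xyz.2.1 xyz.2.2 with h | h | h <;>
      rw [h] <;> norm_num
  rw [hsum, Finset.sum_congr rfl hval, Finset.sum_sub_distrib, Finset.sum_boole, Finset.sum_boole]
  unfold posFibre negFibre
  congr 1 <;> congr 1 <;> convert rfl

omit [Fintype V] [DecidableEq V] in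
/-- `PinnedMM0` is exactly the counting statement `#posFibre ≤ #negFibre` on every fibre. -/
theorem pinnedMM0_iff_card_le :
    PinnedMM0 (R := R) ends s t b u w v ↔
      ∀ pat : Config E × Config E × Config E,
        (posFibre (R := R) ends s t b u w v pat).card ≤
          (negFibre (R := R) ends s t b u w v pat).card := by
  unfold PinnedMM0
  refine forall_congr' fun pat => ?_
  rw [patternCoeff3_eq_card_sub_card, sub_nonpos, Nat.cast_le]

end Fibres

/-! ## Injections and the four-cluster locality -/

section Injection

variable (ends : E → Sym2 V) (s t b u w v : V)

/-- `K⁺_x`: the cluster of `t` in `x + uw` — `C(t)`, enlarged by `C(u)` when `w ∈ C(t)` and by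
`C(w)` when `u ∈ C(t)`. -/
def kplus (x : Config E) : Set V :=
  cluster ends x t ∪ {q | x ∈ connEvent ends t w ∧ q ∈ cluster ends x u} ∪
    {q | x ∈ connEvent ends t u ∧ q ∈ cluster ends x w}

/-- The four-cluster locality set of a triple: `C_x(s) ∪ K⁺_x ∪ C_y(s) ∪ C_z(t)`. -/
def localSet (xyz : Config E × Config E × Config E) : Set V :=
  cluster ends xyz.1 s ∪ kplus ends t u w xyz.1 ∪ cluster ends xyz.2.1 s ∪ cluster ends xyz.2.2 t

/-- A move `xyz ↦ xyz'` is LOCAL if the two triples agree on every edge not touching the locality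
set of `xyz`. -/
def LocalMove (xyz xyz' : Config E × Config E × Config E) : Prop :=
  ∀ e, e ∉ touches ends (localSet ends s t u w xyz) →
    xyz'.1 e = xyz.1 e ∧ xyz'.2.1 e = xyz.2.1 e ∧ xyz'.2.2 e = xyz.2.2 e

variable [LinearOrder R]

/-- **`LocalInjection3`** (NIGHT1-MM0.md §9): on every fibre, an injection from the `+1`-triples to
the `−1`-triples by local moves. -/
def LocalInjection3 : Prop :=
  ∀ pat : Config E × Config E × Config E,
    ∃ f : Config E × Config E × Config E → Config E × Config E × Config E,
      Set.MapsTo f (posFibre (R := R) ends s t b u w v pat) (negFibre (R := R) ends s t b u w v pat) ∧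
      Set.InjOn f (posFibre (R := R) ends s t b u w v pat) ∧
      ∀ xyz ∈ posFibre (R := R) ends s t b u w v pat, LocalMove ends s t u w xyz (f xyz)

variable [IsStrictOrderedRing R]

omit [Fintype V] [DecidableEq V] in
/-- An injection `posFibre(pat) → negFibre(pat)` on every fibre proves `PinnedMM0`. -/
theorem pinnedMM0_of_injection
    (h : ∀ pat : Config E × Config E × Config E,
      ∃ f : Config E × Config E × Config E → Config E × Config E × Config E,
        Set.MapsTo f (posFibre (R := R) ends s t b u w v pat)
          (negFibre (R := R) ends s t b u w v pat) ∧
        Set.InjOn f (posFibre (R := R) ends s t b u w v pat)) :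
    PinnedMM0 (R := R) ends s t b u w v := by
  rw [pinnedMM0_iff_card_le]
  intro pat
  obtain ⟨f, hmaps, hinj⟩ := h pat
  exact Finset.card_le_card_of_injOn f hmaps hinj

omit [Fintype V] [DecidableEq V] in
/-- **`LocalInjection3 → PinnedMM0`**: the local-injection hypothesis proves the pinned statement,
hence (with `mm0minus_of_pinned`) (MM0⁻) for every admissible weight vector. -/
theorem pinnedMM0_of_localInjection3 (h : LocalInjection3 (R := R) ends s t b u w v) :
    PinnedMM0 (R := R) ends s t b u w v :=
  pinnedMM0_of_injection ends s t b u w v fun pat =>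
    let ⟨f, hmaps, hinj, _⟩ := h pat
    ⟨f, hmaps, hinj⟩

omit [Fintype V] [DecidableEq V] in
/-- **`LocalInjection3 → (MM0⁻)`** for every admissible weight vector. -/
theorem mm0minus_of_localInjection3 {p : E → R} (hp : IsProbVec p)
    (h : LocalInjection3 (R := R) ends s t b u w v) : mm0minusForm p ends s t b u w v ≤ 0 :=
  mm0minus_of_pinned hp ends s t b u w v (pinnedMM0_of_localInjection3 ends s t b u w v h)

end Injection

end MM0Pinned
end Summit.Ventures.PercRepro2
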